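import Summits.HubbardSuperconductivity.HubbardSuperconductivity.Theorems.SoloBlindPlaquetteMottFloor
import Summits.HubbardSuperconductivity.HubbardSuperconductivity.Theorems.SoloBlindDimerMottLimit
import HarnessLib

/-!
# The strong-coupling crutch threshold below the Mott-floor limit: `g(1-δ) > 8 - (4-2√2)(4-1/δ)`
# (solo-blind programme, Theorem 42′)

Theorem 34″ (`SoloBlindDimerMottLimit`) decides the competition between the zero-energy Gutzwiller
dimer condensate (crutch gain `≥ (gδ(1-δ)/2) L²`) and the Mott floor of `SoloBlindMottFloor`
(hole term `4 δ L²`): order for every ground state of `K_{U,g} = H_U - (g/L²) Δ_dᴴΔ_d` once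
`g (1-δ) > 8` and `U ≥ 16 + 512/ε`.  The plaquette Mott floor (Theorem 42,
`SoloBlindPlaquetteMottFloor.plaquette_mott_floor_minEnergyOn`) lowers the hole term to
`(4δ - (2-√2)(4δ-1)₊) L²`, so the same bookkeeping gives:

**Theorem 42′ (`plaquetteLimit_crutch_hasLongRangeOrder`).** For `δ ∈ (0, 1/2)`, `g > 0` with
`ε := g δ (1-δ) - 8δ + (4 - 2√2)(4δ - 1) > 0`, i.e. `g (1-δ) > 8 - (4-2√2)(4 - 1/δ)`, and every
`U ≥ 16 + 512/ε`, EVERY normalised ground-state family of `K_{U,g}` in the doped sectors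
`(2⌊(1-δ)L²/2⌋, S_z = 0)` of the even tori has d-wave pair-field long-range order (order density
`ε/8`; even sides `L ≥ 4` with `L² ≥ 4(gδ + 8)/ε`).  The finite-volume inequality is
`plaquetteLimit_trial`.

Numerically the threshold `g(1-δ)` drops from `8` to `7.22 / 6.66 / 6.24 / 5.92 / 5.66` at
`δ = 0.30 / 0.35 / 0.40 / 0.45 / 0.50`; for `δ ≤ 1/4` it is Theorem 34″ again.  The ceiling of the
floor method (Theorem 35′, `SoloBlindNagaokaCeiling`: `4.75 / 4.33 / 3.94 / 3.58 / 3.24` at the same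
densities) is not reached: the plaquette charge `2√2` per two-hole plaquette is the hard-core-boson
value on ONE plaquette, not the Nagaoka/free-hole band bottom.  Honest label as for Theorems 34–34″:
the repulsion acts only as a Mott suppression of the competitors' kinetic energy, the attraction is
the explicit crutch, and obstruction W3 (the corner `g = 0⁺`) is untouched.  Elementary; no sorry.
[this work]
-/

noncomputable section

namespace Summit.HubbardSuperconductivity.HubbardSuperconductivity.Theorems.PlaquetteMottLimit

open Matrix Finset Literature.Probability.LatticeModels Literature.MathematicalPhysics.QuantumLattice
  Literature.MathematicalPhysics.QuantumLattice.EigenvalueContinuation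
open scoped ComplexOrder ComplexConjugate

variable {L : ℕ} [NeZero L]

/-- The `(j+1)`-dimer condensate of Theorem 33, packaged existentially: it lies in the sector
`(2(j+1), S_z = 0)`, is non-zero (`j + 1 ≤ #slots`), has d-wave pair order at least
`2 (j+1) (#slots - j) ‖Ψ‖²`, and Hubbard energy exactly `0` for every `U`. [this work] -/
private theorem exists_zeroEnergy_ordered_trial (hL3 : 3 ≤ L) (hL : Even L) (U : ℝ) {j : ℕ}
    (hj : j + 1 ≤ (DimerCondensate.dimerSlots L).card) :
    ∃ Ψ : Fock (Orb (FermionTorus 2 L)),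
      Ψ ∈ szSector (Λ := FermionTorus 2 L) (2 * (j + 1)) 0 ∧ Ψ ≠ 0 ∧
      2 * ((j + 1 : ℕ) : ℝ) * ((((DimerCondensate.dimerSlots L).card - j : ℕ)) : ℝ) *
          (star Ψ ⬝ᵥ Ψ).re ≤
        (star Ψ ⬝ᵥ ((pairField dWaveFormFactor L)ᴴ * pairField dWaveFormFactor L) *ᵥ Ψ).re ∧
      (star Ψ ⬝ᵥ (hubbardTorus 2 L 1 U *ᵥ Ψ)).re = 0 :=
  ⟨_, DimerCondensate.condensate_mem_szSector (j + 1), DimerCondensate.condensate_ne_zero hj,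
    DimerCondensate.condensate_order_ge hL3 hL j,
    DimerCondensate.re_expect_hubbardTorus_condensate_eq_zero hL U (j + 1)⟩

/-- `0 ≤ 2 - √2`. [folklore] -/
private theorem two_sub_sqrt_two_nonneg : 0 ≤ 2 - Real.sqrt 2 := by
  have : Real.sqrt 2 ≤ 2 := by
    rw [show (2 : ℝ) = Real.sqrt 4 by
      rw [show (4 : ℝ) = 2 ^ 2 by norm_num, Real.sqrt_sq (by norm_num : (0 : ℝ) ≤ 2)]]
    exact Real.sqrt_le_sqrt (by norm_num)
  linarith

/-- **The dimer condensate against the plaquette Mott floor** (even side `L ≥ 4` with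
`L² ≥ 4(gδ + 8)/ε`, `δ ∈ (0, 1/2)`, `g > 0`, `ε = gδ(1-δ) - 8δ + (4-2√2)(4δ-1) > 0`,
`U ≥ 16 + 512/ε`): with `n = ⌊(1-δ)L²/2⌋` there is a non-zero `Ψ` in the sector `(2n, S_z = 0)`
with `re ⟨Ψ, (H_U - (g/L²) Δ_dᴴΔ_d) Ψ⟩ ≤ (minEnergyOn (H_U) (2n, 0) - (ε/8) L²) ‖Ψ‖²`. [this work] -/
theorem plaquetteLimit_trial (hL4 : 4 ≤ L) (hL : Even L) {δ : ℝ}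
    (hδ : δ ∈ Set.Ioo (0 : ℝ) (1 / 2)) {g : ℝ} (hg0 : 0 < g)
    (hε : 0 < g * δ * (1 - δ) - 8 * δ + (4 - 2 * Real.sqrt 2) * (4 * δ - 1)) {U : ℝ}
    (hU : 16 + 512 / (g * δ * (1 - δ) - 8 * δ + (4 - 2 * Real.sqrt 2) * (4 * δ - 1)) ≤ U)
    (hLg : 4 * (g * δ + 8) / (g * δ * (1 - δ) - 8 * δ + (4 - 2 * Real.sqrt 2) * (4 * δ - 1)) ≤
      (L : ℝ) ^ 2) :
    ∃ Ψ : Fock (Orb (FermionTorus 2 L)),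
      Ψ ∈ szSector (Λ := FermionTorus 2 L) (2 * ⌊(1 - δ) * (L : ℝ) ^ 2 / 2⌋₊) 0 ∧ Ψ ≠ 0 ∧
      (star Ψ ⬝ᵥ (hubbardTorus 2 L 1 U + ((-(g / (L : ℝ) ^ 2) : ℝ) : ℂ) •
          ((pairField dWaveFormFactor L)ᴴ * pairField dWaveFormFactor L)) *ᵥ Ψ).re ≤
        ((hubbardTorus 2 L 1 U).minEnergyOn
            (szSector (Λ := FermionTorus 2 L) (2 * ⌊(1 - δ) * (L : ℝ) ^ 2 / 2⌋₊) 0)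
          - (g * δ * (1 - δ) - 8 * δ + (4 - 2 * Real.sqrt 2) * (4 * δ - 1)) / 8 * (L : ℝ) ^ 2) *
          (star Ψ ⬝ᵥ Ψ).re := by
  obtain ⟨hδ0, hδ1⟩ := hδ
  set ε : ℝ := g * δ * (1 - δ) - 8 * δ + (4 - 2 * Real.sqrt 2) * (4 * δ - 1) with hεdef
  have hc0 : 0 ≤ 2 - Real.sqrt 2 := two_sub_sqrt_two_nonneg
  have hL3 : 3 ≤ L := le_trans (by norm_num) hL4
  have hLr : (4 : ℝ) ≤ (L : ℝ) := by exact_mod_cast hL4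
  have hLsq : (16 : ℝ) ≤ (L : ℝ) ^ 2 := by nlinarith
  have h512 : 0 < 512 / ε := by positivity
  have hU16 : 16 ≤ U := by linarith
  have hU0 : 0 < U := by linarith
  have hUε : 512 ≤ U * ε := by
    have h1 : 512 / ε ≤ U := by linarith
    exact (div_le_iff₀ hε).1 h1
  -- the superexchange term of the floor: `64 L²/U ≤ (ε/8) L²`
  have h64 : 64 * (L : ℝ) ^ 2 / U ≤ ε / 8 * (L : ℝ) ^ 2 := by
    rw [div_le_iff₀ hU0]
    have h1 : 64 * (L : ℝ) ^ 2 ≤ (U * ε / 8) * (L : ℝ) ^ 2 :=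
      mul_le_mul_of_nonneg_right (by linarith) (by positivity)
    have h2 : (U * ε / 8) * (L : ℝ) ^ 2 = ε / 8 * (L : ℝ) ^ 2 * U := by ring
    linarith
  -- the size condition: `4 (gδ + 8) ≤ ε L²`
  have hLg' : 4 * (g * δ + 8) ≤ ε * (L : ℝ) ^ 2 :=
    (div_le_iff₀' hε).1 (by simpa [mul_comm] using hLg)
  have harg : 0 ≤ (1 - δ) * (L : ℝ) ^ 2 / 2 := by nlinarith
  -- `n = ⌊(1-δ)L²/2⌋ = j + 1`
  have hn1 : 1 ≤ ⌊(1 - δ) * (L : ℝ) ^ 2 / 2⌋₊ := by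
    rw [Nat.one_le_floor_iff]
    nlinarith
  obtain ⟨j, hj⟩ : ∃ j, ⌊(1 - δ) * (L : ℝ) ^ 2 / 2⌋₊ = j + 1 :=
    ⟨_, (Nat.sub_add_cancel hn1).symm⟩
  have hn_le : ((j + 1 : ℕ) : ℝ) ≤ (1 - δ) * (L : ℝ) ^ 2 / 2 := by
    rw [← hj]; exact Nat.floor_le harg
  have hn_ge : (1 - δ) * (L : ℝ) ^ 2 / 2 - 1 ≤ ((j + 1 : ℕ) : ℝ) := by
    rw [← hj]; linarith [Nat.lt_floor_add_one ((1 - δ) * (L : ℝ) ^ 2 / 2)]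
  rw [hj]
  -- `m = #slots = L²/2`
  set m := (DimerCondensate.dimerSlots L).card with hm
  have h2m : 2 * (m : ℝ) = (L : ℝ) ^ 2 := by
    exact_mod_cast DimerCondensate.two_mul_card_dimerSlots hL
  have hjm : ((j + 1 : ℕ) : ℝ) ≤ (m : ℝ) := by nlinarith
  have hjm' : j + 1 ≤ m := by exact_mod_cast hjm
  have hmj : ((m - j : ℕ) : ℝ) = (m : ℝ) - j := by
    rw [Nat.cast_sub (by omega)]
  -- the trial state
  obtain ⟨Ψ, hΨK, hne, hO, hH⟩ := exists_zeroEnergy_ordered_trial hL3 hL U hjm'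
  have hK : szSector (Λ := FermionTorus 2 L) (2 * (j + 1)) 0 ≠ ⊥ :=
    (Submodule.ne_bot_iff _).2 ⟨Ψ, hΨK, hne⟩
  refine ⟨Ψ, hΨK, hne, ?_⟩
  rw [DimerCondensate.re_rayleigh_add_real_smul]
  set P := (star Ψ ⬝ᵥ Ψ).re with hP
  have hP0 : 0 ≤ P := (re_star_dotProduct_self_pos hne).le
  have hmin := PlaquetteMottFloor.plaquette_mott_floor_minEnergyOn (L := L) hL hU16
    (N := 2 * (j + 1)) (M := 0) hK
  rw [hmj] at hO
  -- abbreviations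
  set n' : ℝ := ((j + 1 : ℕ) : ℝ) with hn'
  set E := (hubbardTorus 2 L 1 U).minEnergyOn (szSector (Λ := FermionTorus 2 L) (2 * (j + 1)) 0)
    with hE
  set RO := (star Ψ ⬝ᵥ
    ((pairField dWaveFormFactor L)ᴴ * pairField dWaveFormFactor L) *ᵥ Ψ).re with hRO
  have hN : (((2 * (j + 1) : ℕ)) : ℝ) = 2 * n' := by rw [hn']; push_cast; ring
  rw [hN] at hmin
  have hjr : (j : ℝ) = n' - 1 := by
    rw [hn']; push_cast; ring
  -- `m - j ≥ δ L² / 2`, `n' ≥ (1-δ) L²/2 - 1`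
  have hmj_ge : δ * (L : ℝ) ^ 2 / 2 ≤ (m : ℝ) - j := by rw [hjr]; linarith
  -- the hole term of the floor: `4 (L² - 2n') ≤ 4 δ L² + 8` and the plaquette gain
  -- `(2-√2) max(0, 4(L² - 2n') - L²) ≥ (2-√2)(4δ - 1) L²`
  have hholes : 4 * ((L : ℝ) ^ 2 - 2 * n') ≤ 4 * δ * (L : ℝ) ^ 2 + 8 := by linarith
  have hmax : (4 * δ - 1) * (L : ℝ) ^ 2 ≤ max 0 (4 * ((L : ℝ) ^ 2 - 2 * n') - (L : ℝ) ^ 2) :=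
    le_trans (by nlinarith) (le_max_right _ _)
  have hgain : (2 - Real.sqrt 2) * ((4 * δ - 1) * (L : ℝ) ^ 2) ≤
      (2 - Real.sqrt 2) * max 0 (4 * ((L : ℝ) ^ 2 - 2 * n') - (L : ℝ) ^ 2) :=
    mul_le_mul_of_nonneg_left hmax hc0
  -- the pairing gain: `(g/L²) · 2 n' (m - j) ≥ g δ n' ≥ (g δ (1-δ)/2) L² - g δ`
  have e1 : g / (L : ℝ) ^ 2 * (2 * n' * (δ * (L : ℝ) ^ 2 / 2)) = g * δ * n' := by
    field_simp
  have e2 : g / (L : ℝ) ^ 2 * (2 * n' * (δ * (L : ℝ) ^ 2 / 2)) ≤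
      g / (L : ℝ) ^ 2 * (2 * n' * ((m : ℝ) - j)) :=
    mul_le_mul_of_nonneg_left (mul_le_mul_of_nonneg_left hmj_ge (by positivity)) (by positivity)
  have q1 : g * δ * ((1 - δ) * (L : ℝ) ^ 2 / 2 - 1) ≤ g * δ * n' :=
    mul_le_mul_of_nonneg_left hn_ge (by positivity)
  have q2 : g * δ * ((1 - δ) * (L : ℝ) ^ 2 / 2 - 1) =
      4 * δ * (L : ℝ) ^ 2 - (2 - Real.sqrt 2) * ((4 * δ - 1) * (L : ℝ) ^ 2) +
        ε / 2 * (L : ℝ) ^ 2 - g * δ := by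
    rw [hεdef]; ring
  have key : 4 * ((L : ℝ) ^ 2 - 2 * n')
        - (2 - Real.sqrt 2) * max 0 (4 * ((L : ℝ) ^ 2 - 2 * n') - (L : ℝ) ^ 2)
        + 64 * (L : ℝ) ^ 2 / U + ε / 8 * (L : ℝ) ^ 2 ≤
      g / (L : ℝ) ^ 2 * (2 * n' * ((m : ℝ) - j)) := by
    linarith [e1, e2, q1, q2, hholes, hgain, h64, hLg']
  -- assemble
  have stepa : -(g / (L : ℝ) ^ 2) * RO ≤ -(g / (L : ℝ) ^ 2) * (2 * n' * ((m : ℝ) - j) * P) :=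
    mul_le_mul_of_nonpos_left hO (by rw [neg_nonpos]; positivity)
  have stepb : (-(g / (L : ℝ) ^ 2 * (2 * n' * ((m : ℝ) - j)))) * P ≤
      (E - ε / 8 * (L : ℝ) ^ 2) * P :=
    mul_le_mul_of_nonneg_right (by linarith) hP0
  linarith [hH, stepa, stepb]

/-- **Theorem 42′ (the strong-coupling crutch threshold below the Mott-floor limit).** For
`δ ∈ (0, 1/2)`, every `g > 0` with `ε = gδ(1-δ) - 8δ + (4-2√2)(4δ-1) > 0` — i.e.
`g(1-δ) > 8 - (4-2√2)(4 - 1/δ)` — and every `U ≥ 16 + 512/ε`, EVERY normalised ground-state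
family of the crutched Hubbard Hamiltonians `H_U - (g/L²) Δ_dᴴ Δ_d` in the doped sectors
`(2⌊(1-δ)L²/2⌋, S_z = 0)` of the even tori has d-wave pair-field long-range order (order density
`ε/8`).  Theorem 34″ is the case without the plaquette term (`g(1-δ) > 8`). [this work] -/
theorem plaquetteLimit_crutch_hasLongRangeOrder {δ : ℝ} (hδ : δ ∈ Set.Ioo (0 : ℝ) (1 / 2))
    {g : ℝ} (hg0 : 0 < g)
    (hε : 0 < g * δ * (1 - δ) - 8 * δ + (4 - 2 * Real.sqrt 2) * (4 * δ - 1)) {U : ℝ}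
    (hU : 16 + 512 / (g * δ * (1 - δ) - 8 * δ + (4 - 2 * Real.sqrt 2) * (4 * δ - 1)) ≤ U)
    (ψ : ∀ L, Fock (Orb (FermionTorus 2 L)))
    (hψ : ∀ m : ℕ, Even (m + 1) → star (ψ (m + 1)) ⬝ᵥ ψ (m + 1) = 1 ∧
      IsGroundStateInSector
        (hubbardTorus 2 (m + 1) 1 U + ((-(g / ((m + 1 : ℕ) : ℝ) ^ 2) : ℝ) : ℂ) •
          ((pairField dWaveFormFactor (m + 1))ᴴ * pairField dWaveFormFactor (m + 1)))
        (2 * ⌊(1 - δ) * ((m + 1 : ℕ) : ℝ) ^ 2 / 2⌋₊) 0 (ψ (m + 1))) :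
    HasLongRangeOrder (fun k => halfOpenBox 2 (2 * k))
      (fun k => torusPullback (pairFieldCorr dWaveFormFactor ψ) (2 * k)) := by
  set ε : ℝ := g * δ * (1 - δ) - 8 * δ + (4 - 2 * Real.sqrt 2) * (4 * δ - 1) with hεdef
  have hκ : 0 < ε / 8 := by positivity
  refine CrutchAxis.crutch_hasLongRangeOrder_of_trials U hg0 hκ
    (L₁ := max 4 ⌈4 * (g * δ + 8) / ε⌉₊)
    (fun m hm hL₁ => plaquetteLimit_trial (L := m + 1) (le_trans (le_max_left _ _) hL₁) hm hδ hg0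
      hε hU ?_) ψ hψ
  have h1 : (⌈4 * (g * δ + 8) / ε⌉₊ : ℝ) ≤ ((m + 1 : ℕ) : ℝ) := by
    exact_mod_cast le_trans (le_max_right 4 _) hL₁
  have h2 : ((m + 1 : ℕ) : ℝ) ≤ ((m + 1 : ℕ) : ℝ) ^ 2 := by
    have h3 : (1 : ℝ) ≤ ((m + 1 : ℕ) : ℝ) := by exact_mod_cast Nat.succ_pos m
    nlinarith
  exact le_trans (Nat.le_ceil _) (h1.trans h2)

/-- **Theorem 42′, threshold form.** For `δ ∈ (0, 1/2)` and every `g > 0` with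
`g (1-δ) > 8 - (4-2√2)(4δ-1)/δ` there is a repulsion threshold `U₁` beyond which every normalised
ground-state family of `H_U - (g/L²) Δ_dᴴ Δ_d` in the summit's doped sectors has d-wave pair-field
long-range order. [this work] -/
theorem exists_threshold_crutch_hasLongRangeOrder {δ : ℝ} (hδ : δ ∈ Set.Ioo (0 : ℝ) (1 / 2))
    {g : ℝ} (hg0 : 0 < g) (hg : 8 - (4 - 2 * Real.sqrt 2) * (4 * δ - 1) / δ < g * (1 - δ)) :
    ∃ U₁ : ℝ, ∀ U : ℝ, U₁ ≤ U →
      ∀ ψ : ∀ L, Fock (Orb (FermionTorus 2 L)),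
        (∀ m : ℕ, Even (m + 1) → star (ψ (m + 1)) ⬝ᵥ ψ (m + 1) = 1 ∧
          IsGroundStateInSector
            (hubbardTorus 2 (m + 1) 1 U + ((-(g / ((m + 1 : ℕ) : ℝ) ^ 2) : ℝ) : ℂ) •
              ((pairField dWaveFormFactor (m + 1))ᴴ * pairField dWaveFormFactor (m + 1)))
            (2 * ⌊(1 - δ) * ((m + 1 : ℕ) : ℝ) ^ 2 / 2⌋₊) 0 (ψ (m + 1))) →
        HasLongRangeOrder (fun k => halfOpenBox 2 (2 * k))
          (fun k => torusPullback (pairFieldCorr dWaveFormFactor ψ) (2 * k)) := by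
  have hδ0 : 0 < δ := hδ.1
  have hε : 0 < g * δ * (1 - δ) - 8 * δ + (4 - 2 * Real.sqrt 2) * (4 * δ - 1) := by
    have h1 := (sub_lt_iff_lt_add.1 hg)
    have h2 : (4 - 2 * Real.sqrt 2) * (4 * δ - 1) / δ * δ = (4 - 2 * Real.sqrt 2) * (4 * δ - 1) :=
      div_mul_cancel₀ _ hδ0.ne'
    nlinarith [mul_lt_mul_of_pos_right hg hδ0]
  exact ⟨16 + 512 / (g * δ * (1 - δ) - 8 * δ + (4 - 2 * Real.sqrt 2) * (4 * δ - 1)),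
    fun U hU ψ hψ => plaquetteLimit_crutch_hasLongRangeOrder hδ hg0 hε hU ψ hψ⟩

end Summit.HubbardSuperconductivity.HubbardSuperconductivity.Theorems.PlaquetteMottLimit
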